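import Summits.BirchSwinnertonDyer.BirchSwinnertonDyer.Theorems.SylvesterTwoHeegnerIndexLevelFixingClassIdentityAsqW
import Summits.BirchSwinnertonDyer.BirchSwinnertonDyer.Theorems.SylvesterTwoHeegnerIndexLevelFixingTransportToFixOrbit
import Literature.NumberTheory.EllipticCurves.HeegnerPointsOfConductorGaloisOrbitPairBezout
import HarnessLib

/-!
# (W2-b) `stub_levelFixingSeven` REDUCED, ON EVERY CLASS AND AT EVERY LEVEL, TO ONE CM SENTENCE:
# «the automorphisms of `ℂ` extending `φ` translate `Cl(−243p²n²)` by `η* = [(243, 243pn, 61(pn)²)]`»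
# (crux `UpperOffV0HSYPlus`, stmt-BirchSwinnertonDyer-19804; route `SylvesterTwoHeegnerIndex`, rung K7t)

Cell `bsd-cm`, seat `bsd-cm-k7t-w2b` g0.  Helper toward `stmt-BirchSwinnertonDyer-19804` (`--supports … --as helper`).  THEOREMS ONLY
(no definition, no named fact, no instance, no notation, no `sorry`).  The ASSEMBLER of this seat's chain: orbit forms on all three
sheets (p750768, p751214), the glue on any sheet (p751443), `η*` and the W-class identity (p751406), the `AW`/`A²W` class identities
(p752102, `…ClassIdentityAsqW`), with the tree's ENGINE `levelTransport_of_transport_lattice_eq_bezout` (B-I, p741040's sequel), Cox 10.9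
`exists_lattice_eq_mulLeft_of_j_eq`, `classJ_classOf'_triple`, and HSY's Bezout datum `isCoprime_bezoutC`.

* ★★ `levelTransport_of_translation_etaStar` — for `p ≡ 7 (mod 9)`, `n ≠ 0` with all prime factors `≡ 2 (mod 3)`, `Δ.D = (9pn)²·(−3)`,
  and ANY `σ ∈ Aut(ℂ)` fixing `√−3` that translates the singular moduli of discriminant `−243p²n²` by `η*`
  (`∀ κ, σ (classJ Δ κ) = classJ Δ (η* · κ)`) and ANY level-`243` Heegner form `Q′` of that discriminant with the residue of `Q_n` and
  class `[Q′] = [Q_n]·η*` (the tabulated partner of `orbitForm_classIdentity_sylvesterTower` is one, with CM point `(Aⁱ·w₂₄₃) • τ_n`):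
  **`LevelTransport 243 σ τ_n (heegnerTau Q′)`** — `σ` carries HSY's CM point `x(τ_n) ∈ X₀(3⁵)` INTO ITS `S₃`-ORBIT.
* ★★★ `levelFixing_of_translation_etaStar` — THE STUB'S CONCLUSION `pointGalHom E₉ K[9pn] (φ.restrictScalars ℚ) y = y` for every
  `⟨W, A⟩`-invariant datum `Dt` (`IsS3Invariant Dt` = (G3), k-ty1's named fact `phi_s3Invariant_of_deg_eq_six` for `deg = 6`), every
  `K`-automorphism `φ` of `K[9pn]` and every `y` over `Dt.φ(τ_n)`, FROM the one displayed CM hypothesis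
  `hCM : ∀ σ extending φ, ∀ κ, σ (classJ Δ κ) = classJ Δ (η* · κ)`.
  For the decomposition involution at `w = (√−3)` this hypothesis is Shimura reciprocity at the idèle `(√−3)_w` (HSY Thm 2.3 /
  memo (W2-b) §2 (c): `η*` = the class of the `O_{9pn}`-ideal attached to `(√−3)_w`); name-free, it is what (4.1) gives at `n = 1, 2`
  (`Cl[2] = {1, η*}`: «σ translates by a non-trivial involutory class», from (G2) `exists_translation_classJ` + `σ² ⊒ φ² = 1` +
  `classJ_injective`) and what (4.2) is to give for all `n`.

HONEST LABEL: CONDITIONAL (`hCM`, `hS3`); no stub closed; nothing asserted on 19804; X12.CMAtTwo NOT proved; BSD is proved for no curve.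

## References
* Y. Hu, J. Shu, H. Yin, Trans. AMS 372 (2019) = arXiv:1708.05266, §2.1 Prop. 2.1 (1), §2.2 Thm. 2.2–2.3, §4.1. [HuShuYin2019]
* B. H. Gross, *Heegner points on `X₀(N)`* (1984), §I.1, §5. [Gross1984]
* D. A. Cox, *Primes of the form x² + ny²*, 2nd ed. (2013), Thm. 10.9, §11.D Cor. 11.37, §7.B Thm. 7.7. [Cox2013]
* H. Darmon, *Rational Points on Modular Elliptic Curves*, CBMS 101 (2004), Thm. 3.6–3.7. [Darmon2004]
-/

set_option autoImplicit false
-- the Summit-side namespace `Summit.BirchSwinnertonDyer.BirchSwinnertonDyer.…` (summit = problem) is mandated by D-0017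
set_option linter.dupNamespace false

noncomputable section

open scoped Classical MatrixGroups

namespace Summit.BirchSwinnertonDyer.BirchSwinnertonDyer.Theorems.SylvesterTwoLevelFixingAssembly

open PeriodPair
open Literature.Computability.Cryptography.Hallgren2005.OrderCl
open Literature.NumberTheory.QuadraticFields.Quadratic
open Literature.NumberTheory.EllipticCurves Literature.NumberTheory.EllipticCurves.HeegnerForm
  Literature.NumberTheory.EllipticCurves.HuShuYin2019 Literature.NumberTheory.EllipticCurves.ModularForms
  Literature.FieldTheory.AlgClosed WeierstrassCurve
  Summit.BirchSwinnertonDyer.BirchSwinnertonDyer.Theorems.SylvesterTwoLevelFixingGlue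
  Summit.BirchSwinnertonDyer.BirchSwinnertonDyer.Theorems.SylvesterTwoLevelFixingGlueOrbit
  Summit.BirchSwinnertonDyer.BirchSwinnertonDyer.Theorems.SylvesterTwoLevelFixingOrbitA
  Summit.BirchSwinnertonDyer.BirchSwinnertonDyer.Theorems.SylvesterTwoLevelFixingClassA

variable {K : Type} [Field K] [NumberField K]

/-- ★★ **A translation by `η*` carries `x(τ_n)` into its `S₃`-orbit.**  `p ≡ 7 (mod 9)`, `n ≠ 0` with all prime factors `≡ 2 (mod 3)`,
`Δ.D = (9pn)²·(−3)`; `σ ∈ Aut(ℂ)` fixes `√−3` and `σ (classJ Δ κ) = classJ Δ (η* · κ)` for every class `κ` of discriminant `−243p²n²`.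
Then `LevelTransport 243 σ τ_n (heegnerTau Q′)` for the tabulated partner `Q′` (`heegnerTau Q′ = (Aⁱ·w₂₄₃) • τ_n`, some `i < 3`):
`σ(j(τ_n)) = j(η*·[Q_n]) = j([Q′]) = j(τ_{Q′})` (`classJ_classOf'_triple`, `orbitForm_classIdentity_sylvesterTower`), so the transport of
`Λ_{τ_n}` is homothetic to `Λ_{τ_{Q′}}` (Cox 10.9 `exists_lattice_eq_mulLeft_of_j_eq`), and the engine `levelTransport_of_transport_lattice_eq_bezout`
(Bezout datum `β = nB`, `c = n²(P₁/3)C`, `u·243 + w·c = 1`: `isCoprime_bezoutC`; equal residues: `orbitForm_…`) transports the level structure.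
[cite: Gross1984, §I.1, §5] [cite: Cox2013, Thm. 10.9, §7.B Thm. 7.7] [cite: HuShuYin2019, §2.2 Thm. 2.3] -/
theorem levelTransport_of_translation_etaStar {p : ℕ} (hp3 : p % 3 = 1) {n : ℕ} (hn : n ≠ 0)
    (hprimes : ∀ q ∈ n.primeFactors, q % 3 = 2) (Δ : NegDiscr) (hΔ : Δ.D = ((9 * p * n : ℕ) : ℤ) ^ 2 * (-3))
    {Q' : ℤ × ℤ × ℤ} (hQ' : Q' ∈ heegnerForms 243 (((9 * p * n : ℕ) : ℤ) ^ 2 * (-3)))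
    (hres : Q'.2.1 ≡ (n : ℤ) * (-(9 * (4 * (p : ℤ) ^ 2 + 17 * p + 72))) [ZMOD 2 * 243])
    (hcls : classOf' Δ ⟨Q'.1, Q'.2.1, Q'.2.2⟩ =
      classOf' Δ ⟨(n : ℤ) ^ 2 * (81 * ((p : ℤ) ^ 2 + 4 * p + 16)),
        (n : ℤ) * (-(9 * (4 * (p : ℤ) ^ 2 + 17 * p + 72))), 4 * (p : ℤ) ^ 2 + 18 * p + 81⟩ *
      classOf' Δ ⟨243, 243 * ((p * n : ℕ) : ℤ), 61 * ((p * n : ℕ) : ℤ) ^ 2⟩)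
    {σ : ℂ ≃+* ℂ} (hσ3 : σ (sqrtDisc (-3)) = sqrtDisc (-3))
    (hσj : ∀ κ : ClassGroup (QO Δ),
      σ (classJ Δ κ) = classJ Δ (classOf' Δ ⟨243, 243 * ((p * n : ℕ) : ℤ), 61 * ((p * n : ℕ) : ℤ) ^ 2⟩ * κ)) :
    LevelTransport 243 σ
      (heegnerTau ((n : ℤ) ^ 2 * (81 * ((p : ℤ) ^ 2 + 4 * p + 16)),
        (n : ℤ) * (-(9 * (4 * (p : ℤ) ^ 2 + 17 * p + 72))), 4 * (p : ℤ) ^ 2 + 18 * p + 81))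
      (heegnerTau Q') := by
  haveI : NeZero (243 : ℕ) := ⟨by norm_num⟩
  have hp0 : 0 < p := by omega
  have hn3 : ¬ 3 ∣ n := by
    intro h
    have h3 := hprimes 3 (Nat.mem_primeFactors.mpr ⟨Nat.prime_three, h, hn⟩)
    omega
  have hnC := isCoprime_C_of_forall_prime_mod_three_eq_two (p := p) hn hprimes
  have hQ := sylvesterForm_mem_heegnerForms hp3 hn hnC
  have hf : 9 * p * n ≠ 0 := Nat.mul_ne_zero (Nat.mul_ne_zero (by norm_num) hp0.ne') hn
  have hD : ((9 * p * n : ℕ) : ℤ) ^ 2 * (-3) < 0 := by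
    have h9' : (0 : ℤ) < ((9 * p * n : ℕ) : ℤ) := by exact_mod_cast Nat.pos_of_ne_zero hf
    nlinarith
  have hσD : σ (sqrtDisc (((9 * p * n : ℕ) : ℤ) ^ 2 * (-3))) = sqrtDisc (((9 * p * n : ℕ) : ℤ) ^ 2 * (-3)) :=
    (apply_sqrtDisc_sq_mul_eq_iff σ (-3) hf).mpr hσ3
  -- the two forms as primitive positive definite `BinQF`s of discriminant `Δ.D`
  have hQpp : (⟨(n : ℤ) ^ 2 * (81 * ((p : ℤ) ^ 2 + 4 * p + 16)), (n : ℤ) * (-(9 * (4 * (p : ℤ) ^ 2 + 17 * p + 72))),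
      4 * (p : ℤ) ^ 2 + 18 * p + 81⟩ : BinQF).IsPosPrim Δ.D := by
    rw [hΔ]; exact ⟨hQ.1, hQ.2.1, (BinQF.isPrimitive_iff _).mpr hQ.2.2.2⟩
  have hQ'pp : (⟨Q'.1, Q'.2.1, Q'.2.2⟩ : BinQF).IsPosPrim Δ.D := by
    rw [hΔ]; exact ⟨hQ'.1, hQ'.2.1, (BinQF.isPrimitive_iff _).mpr hQ'.2.2.2⟩
  -- `σ(j(τ_n)) = j(τ_{Q′})`
  have hσj' : σ (formJ ((n : ℤ) ^ 2 * (81 * ((p : ℤ) ^ 2 + 4 * p + 16)),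
      (n : ℤ) * (-(9 * (4 * (p : ℤ) ^ 2 + 17 * p + 72))), 4 * (p : ℤ) ^ 2 + 18 * p + 81)) = formJ Q' := by
    have h1 : classJ Δ (classOf' Δ ⟨(n : ℤ) ^ 2 * (81 * ((p : ℤ) ^ 2 + 4 * p + 16)),
        (n : ℤ) * (-(9 * (4 * (p : ℤ) ^ 2 + 17 * p + 72))), 4 * (p : ℤ) ^ 2 + 18 * p + 81⟩) =
        formJ ((n : ℤ) ^ 2 * (81 * ((p : ℤ) ^ 2 + 4 * p + 16)),
          (n : ℤ) * (-(9 * (4 * (p : ℤ) ^ 2 + 17 * p + 72))), 4 * (p : ℤ) ^ 2 + 18 * p + 81) :=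
      classJ_classOf'_triple (Δ := Δ)
        (Q := ((n : ℤ) ^ 2 * (81 * ((p : ℤ) ^ 2 + 4 * p + 16)),
          (n : ℤ) * (-(9 * (4 * (p : ℤ) ^ 2 + 17 * p + 72))), 4 * (p : ℤ) ^ 2 + 18 * p + 81)) hQpp
    have h2 := classJ_classOf'_triple (Δ := Δ) hQ'pp
    have hmul : classOf' Δ ⟨243, 243 * ((p * n : ℕ) : ℤ), 61 * ((p * n : ℕ) : ℤ) ^ 2⟩ *
        classOf' Δ ⟨(n : ℤ) ^ 2 * (81 * ((p : ℤ) ^ 2 + 4 * p + 16)), (n : ℤ) * (-(9 * (4 * (p : ℤ) ^ 2 + 17 * p + 72))),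
          4 * (p : ℤ) ^ 2 + 18 * p + 81⟩ = classOf' Δ ⟨Q'.1, Q'.2.1, Q'.2.2⟩ := by
      rw [mul_comm]; exact hcls.symm
    rw [← h1, hσj, hmul, h2]
  -- transport of `Λ_{τ_n}` along `σ`: same `j` as `Λ_{τ_{Q′}}`, hence homothetic to it
  obtain ⟨M, hM⟩ := exists_isTransportedBy σ (ofUpperHalfPlane (heegnerTau ((n : ℤ) ^ 2 * (81 * ((p : ℤ) ^ 2 + 4 * p + 16)),
    (n : ℤ) * (-(9 * (4 * (p : ℤ) ^ 2 + 17 * p + 72))), 4 * (p : ℤ) ^ 2 + 18 * p + 81)))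
  have hjM : (ofUpperHalfPlane (heegnerTau Q')).j = M.j := by
    rw [hM.j_eq, ← formJ_def, ← formJ_def, hσj']
  obtain ⟨c₀, hc₀, hMc⟩ := exists_lattice_eq_mulLeft_of_j_eq hjM
  -- Bezout datum `β = nB`, `c = n²((p²+4p+16)/3)C`, `u·243 + 0·β + w·c = 1`
  obtain ⟨k, rfl⟩ : ∃ k : ℕ, p = 3 * k + 1 := ⟨p / 3, by omega⟩
  obtain ⟨u, w, huw⟩ := isCoprime_bezoutC (k := k) (n := n) hn3
  refine levelTransport_of_transport_lattice_eq_bezout (N := 243) hD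
    (β := (n : ℤ) * (-(9 * (4 * ((3 * k + 1 : ℕ) : ℤ) ^ 2 + 17 * ((3 * k + 1 : ℕ) : ℤ) + 72))))
    (c := (n : ℤ) ^ 2 * (3 * (k : ℤ) ^ 2 + 6 * k + 7) * (4 * ((3 * k + 1 : ℕ) : ℤ) ^ 2 + 18 * (3 * k + 1 : ℕ) + 81))
    (u := u) (v := 0) (w := w) ?_ ?_ hσD hQ (Int.ModEq.refl _) hQ' hres hM hc₀ hMc
  · push_cast
    ring
  · linear_combination huw

/-- ★★★ **(W2-b) ON EVERY CLASS AND AT EVERY LEVEL, FROM ONE CM SENTENCE.**  Binders of `stub_levelFixingSeven` (`p ≡ 7 (mod 9)`,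
`K ∋ ω` with `ω² + ω + 1 = 0`, `[K:ℚ] = 2`, `ι`, `n ≠ 0` with all prime factors `≡ 2 (mod 3)`), a datum `Dt` with `IsS3Invariant Dt`
((G3) = HSY Prop. 2.1 (1)), ANY `K`-automorphism `φ` of `K[9pn]`, ANY `y ∈ E₉(K[9pn])` over `Dt.φ(τ_n)`, and a discriminant datum
`Δ.D = (9pn)²·(−3)`.  DISPLAYED HYPOTHESIS `hCM`: every automorphism `σ` of `ℂ` extending `φ` translates the singular moduli of
discriminant `−243p²n²` by `η* = [(243, 243pn, 61(pn)²)]` — for the decomposition involution at `w = (√−3)` this is Shimura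
reciprocity at the idèle `(√−3)_w` (HSY Thm 2.3; the seat memo §2 (c)); at `n = 1, 2` it follows name-free from (G2) and
`Cl(−243p²n²)[2] = {1, η*}`.  CONCLUSION: the stub's, `pointGalHom E₉ K[9pn] (φ.restrictScalars ℚ) y = y`.
Proof: `levelFixing_of_levelTransport_sheet` (p751443) fed with `levelTransport_of_translation_etaStar` (the extension `σ` fixes `ι(K)`,
hence `√−3`: `ringEquiv_apply_eq_of_extends`, `apply_sqrtDisc_discr_eq`).  CONDITIONAL (`hCM`, `hS3`); no stub closed; BSD is not proved
by any of this. [cite: HuShuYin2019, §2.1 Prop. 2.1 (1), §2.2 Thm. 2.3, §4.1] [cite: Darmon2004, Thm. 3.6–3.7] [cite: Gross1984, §I.1, §5] -/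
theorem levelFixing_of_translation_etaStar
    (Dt : ModularParametrizationData (⟨0, 0, 1, 0, -1⟩ : WeierstrassCurve ℚ) 243) (hS3 : IsS3Invariant Dt)
    {p : ℕ} (h9 : p % 9 = 7) {ω : K} (hω : ω ^ 2 + ω + 1 = 0) (h2 : Module.finrank ℚ K = 2)
    (ι : K →+* ℂ) {n : ℕ} (hn : n ≠ 0) (hprimes : ∀ q ∈ n.primeFactors, q % 3 = 2)
    (φ : ringClassField K ι (9 * p * n) ≃ₐ[K] ringClassField K ι (9 * p * n))
    (Δ : NegDiscr) (hΔ : Δ.D = ((9 * p * n : ℕ) : ℤ) ^ 2 * (-3))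
    (hCM : ∀ σ : ℂ ≃+* ℂ, (∀ x : ringClassField K ι (9 * p * n), σ x = ((φ x : ringClassField K ι (9 * p * n)) : ℂ)) →
      ∀ κ : ClassGroup (QO Δ),
        σ (classJ Δ κ) = classJ Δ (classOf' Δ ⟨243, 243 * ((p * n : ℕ) : ℤ), 61 * ((p * n : ℕ) : ℤ) ^ 2⟩ * κ))
    (y : (((⟨0, 0, 1, 0, -1⟩ : WeierstrassCurve ℚ)).baseChange (ringClassField K ι (9 * p * n))).toAffine.Point)
    (hy : Affine.Point.map (W' := (⟨0, 0, 1, 0, -1⟩ : WeierstrassCurve ℚ))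
        (ringClassField K ι (9 * p * n)).subtype.toRatAlgHom y =
      Dt.φ (heegnerTau ((n : ℤ) ^ 2 * (81 * ((p : ℤ) ^ 2 + 4 * p + 16)),
        (n : ℤ) * (-(9 * (4 * (p : ℤ) ^ 2 + 17 * p + 72))), 4 * (p : ℤ) ^ 2 + 18 * p + 81))) :
    pointGalHom (⟨0, 0, 1, 0, -1⟩ : WeierstrassCurve ℚ) (ringClassField K ι (9 * p * n)) (φ.restrictScalars ℚ) y = y := by
  have hK : IsImaginaryQuadratic K := JZero.isImaginaryQuadratic_of_sq_add_self_add_one hω h2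
  have hdK : NumberField.discr K = -3 := JZero.discr_eq_neg_three_of_sq_add_self_add_one hω h2
  have hp3 : p % 3 = 1 := by omega
  -- the sheet datum, with the transport supplied by `hCM` for every extension `σ` of `φ`
  have hsheet : ∃ i : ℕ, i < 3 ∧ ∃ Q' ∈ heegnerForms 243 (((9 * p * n : ℕ) : ℤ) ^ 2 * (-3)),
      heegnerTau Q' = glCast (hsyA ^ i * (frickeGL 243 : GL (Fin 2) ℚ)) •
        heegnerTau ((n : ℤ) ^ 2 * (81 * ((p : ℤ) ^ 2 + 4 * p + 16)),
          (n : ℤ) * (-(9 * (4 * (p : ℤ) ^ 2 + 17 * p + 72))), 4 * (p : ℤ) ^ 2 + 18 * p + 81) ∧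
      ∀ σ : ℂ ≃+* ℂ, (∀ x : ringClassField K ι (9 * p * n), σ x = ((φ x : ringClassField K ι (9 * p * n)) : ℂ)) →
        LevelTransport 243 σ
          (heegnerTau ((n : ℤ) ^ 2 * (81 * ((p : ℤ) ^ 2 + 4 * p + 16)),
            (n : ℤ) * (-(9 * (4 * (p : ℤ) ^ 2 + 17 * p + 72))), 4 * (p : ℤ) ^ 2 + 18 * p + 81))
          (heegnerTau Q') := by
    obtain ⟨i, hi, Q', hQ', hres, hτ, hcls⟩ := orbitForm_classIdentity_sylvesterTower Δ h9 hn hprimes hΔ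
    refine ⟨i, hi, Q', hQ', hτ, fun σ hσ ↦ ?_⟩
    -- `σ` fixes `ι(K)`, hence `√−3`
    have hσK : ∀ k : K, σ (ι k) = ι k := ringEquiv_apply_eq_of_extends ι (9 * p * n) φ hσ
    have hσ3 : σ (sqrtDisc (-3)) = sqrtDisc (-3) := by
      have h := apply_sqrtDisc_discr_eq hK ι hσK
      rwa [hdK] at h
    exact levelTransport_of_translation_etaStar hp3 hn hprimes Δ hΔ hQ' hres hcls hσ3 (hCM σ hσ)
  exact levelFixing_of_levelTransport_sheet Dt hS3 hp3 hω h2 ι hn hprimes φ hsheet y hy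

end Summit.BirchSwinnertonDyer.BirchSwinnertonDyer.Theorems.SylvesterTwoLevelFixingAssembly

end
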